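import Summits.BirchSwinnertonDyer.BirchSwinnertonDyer.Theorems.ResidualThetaTransportAtTwoSignedMuVanishingAtTwoPlusCuspSpanFlat
import Summits.BirchSwinnertonDyer.BirchSwinnertonDyer.Theorems.ResidualThetaTransportAtTwoSignedMuVanishingAtTwoPlusOldClassTransport
import HarnessLib

/-!
# Route `ResidualThetaTransportAtTwo`, crux Kμ⁺ `SignedMuVanishingAtTwoPlus` (stmt-BirchSwinnertonDyer-20689),
# line `birth`, stub `stub_flatMuZeroAtTwo`: OLD-CLASS DESCENT OF FLAT — a mod-2 congruence of plus symbols with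
# an old class of LOWER level transports «some even-layer Mazur–Tate coefficient is a 2-adic unit» upwards

Cell `bsd-wall`, width seat `bsd-wall-rtt-p4-w2` (g3). THEOREMS ONLY (no `def`, no named fact, no `sorry`); helper
`--supports` the crux; the congruence is a HYPOTHESIS here (its source — mod-2 multiplicity one, Buzzard 2000 Prop. 2.4,
plus Ihara — is explained in the crux workfile `CuspSpanIhara.md`); BSD is not proved by this.

## The statement (`exists_odd_of_plusSymbol_congruence`, `flatAtTwo_of_plusSymbol_congruence`)

Let `f` be a normalised newform of ODD level `N` with rational coefficients (the habitat⁺ newform `f_W`, `a₂ = 0`), and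
`g` a normalised newform of odd level `N₀` with rational coefficients and `a₂(g) = a` EVEN (think: the newform of a
mod-2 congruent elliptic curve `A` with `N_A ∣ N_W`). Write `M_h(x) := 2([x]⁺_h − [0]⁺_h)` (`[x]⁺ = ratPlusSymbol`; an
INTEGER at every cusp `x` with denominator prime to the level — the doubled plus period `2 re{∞, γ∞}_h/Ω⁺_h` of
`…CuspSpanHecke`). ASSUME the mod-2 CONGRUENCE OF PLUS SYMBOLS on the even `2`-power cusps
  (C)  `M_f(b/4^k) ≡ ∑_{t ∈ S} M_g(t b/4^k) (mod 2)`   (`k ≥ 1`, `b` odd; `S ≠ ∅` a finite set of odd `t`),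
the shape of «the mod-2 plus character of `f` is the old class `∑_{t∈S} α_t^* χ_g`» restricted to the loops
`{0 → b/4^k}` (`A_t γ A_t⁻¹ · 0 = t · γ0`). THEN: if SOME `M_g(b/4^k)` (`k ≥ 1`, `b` odd) is odd, SOME `M_f(b'/4^{k'})` is odd
— hence (lead g5 p593268 / w3 p578368) `2 ∤ L♭` for every Pollack pair of `f` at `2`: FLAT at `(W, f)`.

Proof: if every `M_f(b/4^k)` were even, (C) says `∑_t F_k(t b) = 0` for `F_k(b) := M_g(b/4^k) mod 2`; the `F_k` are
`4^k`-periodic, even (`[−x]⁺ = [x]⁺`) and satisfy the `T₂`-distribution relations of `…OldClassTransport` (the Hecke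
relation `a[x]⁺ = [x/2]⁺ + [(x+1)/2]⁺ + [2x]⁺`, `a` even, at `x = b/2^{2k+1}` and `x = b/2`); so the transport lemma
`eq_zero_of_sum_dilations_eq_zero` (p596916 + `…OldClassTransport`) forces every `M_g(b/4^k)` even — contradiction.

## Why this matters (numbers in `CuspSpanIhara.md`)
FLAT becomes a RESIDUAL invariant that DESCENDS to divisor levels: for a habitat⁺ class `W` with a mod-2 congruent newform `g`
of level `N₀ ∣ N_W` (e.g. an anchor curve `A`, `A[2] ≃ W[2]`, `N_A ∣ N_W`), FLAT(W) ⟸ (C) ∧ «one odd `M_g(b/4^k)`», and the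
layer-`0` certificate `(a−3)(a+1)·L(g,1)/Ω⁺_g` odd (`exists_odd_of_layerZero`, from w2 g2's `two_mul_ratPlusSymbol_quarter_eq`)
serves RANK-ONE `W` through a RANK-ZERO partner. (C) itself follows from mod-2 multiplicity one at level `N_W` (Buzzard 2000,
Prop. 2.4: `W[2]` is ramified at `2` for `W` supersingular at `2`) — a PRINT input, not typed here.

References: K. Buzzard, Math. Res. Lett. 7 (2000) Prop. 2.4 [Buzzard2000]; M. Emerton, R. Pollack, T. Weston, Invent. Math.
163 (2006) §4.4 [EmertonPollackWeston2006]; B. Mazur, J. Tate, J. Teitelbaum, Invent. Math. 84 (1986) §I.4 (4.2), §I.8,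
§I.13 [MazurTateTeitelbaum1986Invent]; R. Pollack, Duke Math. J. 118 (2003) Conj. 6.3, Prop. 6.18 [Pollack2003].
-/

set_option autoImplicit false
set_option linter.dupNamespace false

noncomputable section

open scoped Classical MatrixGroups ModularForm

open CongruenceSubgroup WeierstrassCurve Literature.NumberTheory.EllipticCurves
  Literature.NumberTheory.EllipticCurves.ModularForms Literature.NumberTheory.EllipticCurves.Rank1Residual
  Literature.NumberTheory.IwasawaTheory Summit.BirchSwinnertonDyer.Rank1Residual.Supersingular
  Summit.BirchSwinnertonDyer.BirchSwinnertonDyer.Theses.ResidualThetaTransportAtTwo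

namespace Summit.BirchSwinnertonDyer.BirchSwinnertonDyer.Theorems.SignedMuAtTwo

/-! ## §1. Doubled plus symbols `M(x) = 2([x]⁺ − [0]⁺)` of a rational newform: integrality and the `T₂`-relation -/

section Symbols

/-- A cusp `c/2^j` has denominator prime to an odd level. [folklore] -/
theorem coprime_den_div_two_pow {N : ℕ} (h2N : ¬ 2 ∣ N) (c : ℤ) (j : ℕ) :
    Nat.Coprime (((c : ℚ) / 2 ^ j).den) N := by
  have h : ((c : ℚ) / 2 ^ j) = Rat.divInt c (2 ^ j) := by rw [Rat.divInt_eq_div]; push_cast; rfl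
  have hdvd : (((c : ℚ) / 2 ^ j).den : ℤ) ∣ (2 ^ j : ℤ) := by rw [h]; exact Rat.den_dvd c (2 ^ j)
  have hdvd' : ((c : ℚ) / 2 ^ j).den ∣ 2 ^ j := by exact_mod_cast hdvd
  have h2 : Nat.Coprime (2 ^ j) N :=
    Nat.Coprime.pow_left j ((Nat.Prime.coprime_iff_not_dvd Nat.prime_two).mpr h2N)
  exact Nat.Coprime.coprime_dvd_left hdvd' h2

variable {N : ℕ} [NeZero N] (f : CuspForm (Gamma0 N) 2)

/-- **`2([x]⁺_f − [0]⁺_f) ∈ ℤ`** at a cusp with denominator prime to the level (real coefficients; Manin).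
[cite: MazurTateTeitelbaum1986Invent, §I.8] [cite: CremonaAlgorithms1997, §2.8] -/
theorem exists_two_mul_ratPlusSymbol_sub_eq_intCast (hreal : ∀ n, (cuspCoeff f n).im = 0) {x : ℚ}
    (hx : Nat.Coprime x.den N) : ∃ m : ℤ, 2 * (ratPlusSymbol f x - ratPlusSymbol f 0) = m := by
  obtain ⟨m, hm⟩ := exists_ratPlusSymbol_eq_add_div_two f hreal hx
  exact ⟨m, by rw [hm]; ring⟩

/-- **The Hecke relation at `2` for rational plus symbols**: `a₂[r]⁺ = [r/2]⁺ + [(r+1)/2]⁺ + [2r]⁺` for a normalised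
newform of odd level with rational coefficients and `a₂(f) = a`. [cite: MazurTateTeitelbaum1986Invent, §I.4 (4.2)] -/
theorem intCast_mul_ratPlusSymbol_two (hf : IsNewform0 f) (hQ : coeffField f = ⊥) (h2N : ¬ 2 ∣ N) {a : ℤ}
    (ha : cuspCoeff f 2 = a) (r : ℚ) :
    (a : ℚ) * ratPlusSymbol f r = ratPlusSymbol f (r / 2) + ratPlusSymbol f ((r + 1) / 2) + ratPlusSymbol f (2 * r) := by
  have h := intCast_mul_normalizedPlusSymbol (p := 2) hf Nat.prime_two h2N ha r
  rw [Fin.sum_univ_two] at h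
  simp only [Fin.val_zero, Fin.val_one, Nat.cast_zero, Nat.cast_one, add_zero, Nat.cast_ofNat] at h
  apply Rat.cast_injective (α := ℝ)
  push_cast
  rw [ratCast_ratPlusSymbol_holds hf hQ, ratCast_ratPlusSymbol_holds hf hQ, ratCast_ratPlusSymbol_holds hf hQ,
    ratCast_ratPlusSymbol_holds hf hQ, h]

/-- **The `T₂`-distribution relation for `M(x) = 2([x]⁺ − [0]⁺)`**:
`M(x/2) + M((x+1)/2) + M(2x) = a·M(x) + M(1/2)` (the Hecke relation at `x` and at `0`, where `[1/2]⁺ = (a−2)[0]⁺`).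
[cite: MazurTateTeitelbaum1986Invent, §I.4 (4.2)] -/
theorem distribution_two_mul_ratPlusSymbol_sub (hf : IsNewform0 f) (hQ : coeffField f = ⊥) (h2N : ¬ 2 ∣ N) {a : ℤ}
    (ha : cuspCoeff f 2 = a) (x : ℚ) :
    2 * (ratPlusSymbol f (x / 2) - ratPlusSymbol f 0) + 2 * (ratPlusSymbol f ((x + 1) / 2) - ratPlusSymbol f 0) +
        2 * (ratPlusSymbol f (2 * x) - ratPlusSymbol f 0) =
      (a : ℚ) * (2 * (ratPlusSymbol f x - ratPlusSymbol f 0)) + 2 * (ratPlusSymbol f (1 / 2) - ratPlusSymbol f 0) := by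
  have h1 := intCast_mul_ratPlusSymbol_two f hf hQ h2N ha x
  have h0 := intCast_mul_ratPlusSymbol_two f hf hQ h2N ha 0
  simp only [zero_div, zero_add, mul_zero] at h0
  linear_combination (-2 : ℚ) * h1 + 2 * h0

end Symbols

/-! ## §2. One pair of newforms: the congruence transports an odd doubled plus symbol from `g` to `f` -/

section Transport

variable {N : ℕ} [NeZero N] (f : CuspForm (Gamma0 N) 2) {N₀ : ℕ} [NeZero N₀] (g : CuspForm (Gamma0 N₀) 2)

/-- **OLD-CLASS DESCENT (one pair of newforms).** Let `f` (level `N` odd) and `g` (level `N₀` odd, `a₂(g) = a` EVEN) be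
normalised newforms with rational coefficients, `S ≠ ∅` a finite set of odd naturals. ASSUME the mod-2 congruence of
doubled plus symbols on the even `2`-power cusps, `2([b/4^k]⁺_f − [0]⁺_f) − ∑_{t∈S} 2([tb/4^k]⁺_g − [0]⁺_g) ∈ 2ℤ`
(`k ≥ 1`, `b` odd). If some `[b/4^k]⁺_g = [0]⁺_g + m/2` with `m` ODD (`k ≥ 1`, `b` odd), then some
`[b'/4^{k'}]⁺_f = [0]⁺_f + m'/2` with `m'` ODD (`k' ≥ 1`, `b'` odd). Mechanism: the transport lemma
`OldClassTransport.eq_zero_of_sum_dilations_eq_zero` applied to `F_k(b) = 2([b/4^k]⁺_g − [0]⁺_g) mod 2`, whose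
`T₂`-distribution relations are `distribution_two_mul_ratPlusSymbol_sub` at `x = b/2^{2k+1}` and `x = b/2`.
[cite: EmertonPollackWeston2006, Lemma 4.4.4 and Prop. 4.4.5 (mod-2 even-layer shadow)] [cite: MazurTateTeitelbaum1986Invent, §I.4 (4.2), §I.8] -/
theorem exists_odd_of_plusSymbol_congruence (hQ : coeffField f = ⊥) (h2N : ¬ 2 ∣ N)
    (hg : IsNewform0 g) (hQg : coeffField g = ⊥) (h2N₀ : ¬ 2 ∣ N₀) {a : ℤ} (ha : cuspCoeff g 2 = a) (haev : Even a)
    (S : Finset ℕ) (hS : S.Nonempty) (hodd : ∀ t ∈ S, Odd t)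
    (hcong : ∀ k : ℕ, 1 ≤ k → ∀ b : ℤ, Odd b → ∃ z : ℤ,
      2 * (ratPlusSymbol f ((b : ℚ) / 4 ^ k) - ratPlusSymbol f 0) -
        ∑ t ∈ S, 2 * (ratPlusSymbol g ((((t : ℤ) * b : ℤ) : ℚ) / 4 ^ k) - ratPlusSymbol g 0) = 2 * z)
    (hres : ∃ k : ℕ, 1 ≤ k ∧ ∃ b : ℤ, Odd b ∧ ∃ m : ℤ, Odd m ∧
      ratPlusSymbol g ((b : ℚ) / 4 ^ k) = ratPlusSymbol g 0 + (m : ℚ) / 2) :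
    ∃ k : ℕ, 1 ≤ k ∧ ∃ b : ℤ, Odd b ∧ ∃ m : ℤ, Odd m ∧
      ratPlusSymbol f ((b : ℚ) / 4 ^ k) = ratPlusSymbol f 0 + (m : ℚ) / 2 := by
  have hrealf : ∀ n, (cuspCoeff f n).im = 0 := cuspCoeff_im_eq_zero_of_coeffField_eq_bot hQ
  have hrealg : ∀ n, (cuspCoeff g n).im = 0 := cuspCoeff_im_eq_zero_of_coeffField_eq_bot hQg
  -- the integer-valued doubled symbols of `g` at the `2`-power cusps, reduced mod 2
  set Mg : ℚ → ℚ := fun x ↦ 2 * (ratPlusSymbol g x - ratPlusSymbol g 0) with hMg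
  have hMg_int : ∀ (c : ℤ) (j : ℕ), ∃ m : ℤ, Mg ((c : ℚ) / 2 ^ j) = m := fun c j ↦
    exists_two_mul_ratPlusSymbol_sub_eq_intCast g hrealg (coprime_den_div_two_pow h2N₀ c j)
  set F : ℕ → ℤ → ZMod 2 := fun k b ↦ (((Mg ((b : ℚ) / 4 ^ k)).num : ℤ) : ZMod 2) with hF
  -- evaluation: if `Mg x = m` then the reduction is `m mod 2`
  have hnum : ∀ (x : ℚ) (m : ℤ), Mg x = m → ((Mg x).num : ZMod 2) = (m : ZMod 2) := by
    intro x m h; rw [h, Rat.num_intCast]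
  have h4pow : ∀ k : ℕ, ((4 : ℚ) ^ k) = 2 ^ (2 * k) := fun k ↦ by rw [pow_mul]; norm_num
  have hFval : ∀ (k : ℕ) (b m : ℤ), Mg ((b : ℚ) / 4 ^ k) = m → F k b = (m : ZMod 2) := by
    intro k b m h; exact hnum _ _ h
  -- integrality at `b/4^k`
  have hMg_int4 : ∀ (k : ℕ) (b : ℤ), ∃ m : ℤ, Mg ((b : ℚ) / 4 ^ k) = m := by
    intro k b; rw [h4pow]; exact hMg_int b (2 * k)
  -- additivity tool: a `ZMod 2`-valued identity from a `ℚ`-identity between integers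
  have hcast : ∀ (q₁ q₂ q₃ : ℚ) (m₁ m₂ m₃ m₄ e : ℤ), q₁ = m₁ → q₂ = m₂ → q₃ = m₃ →
      q₁ + q₂ + q₃ = (a : ℚ) * m₄ + e →
      (m₁ : ZMod 2) + (m₂ : ZMod 2) + (m₃ : ZMod 2) = (e : ZMod 2) := by
    intro q₁ q₂ q₃ m₁ m₂ m₃ m₄ e h1 h2 h3 h
    rw [h1, h2, h3] at h
    have hZ : m₁ + m₂ + m₃ = a * m₄ + e := by exact_mod_cast h
    obtain ⟨r, hr⟩ := haev
    have : (m₁ : ZMod 2) + m₂ + m₃ = ((a * m₄ + e : ℤ) : ZMod 2) := by rw [← hZ]; push_cast; ring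
    rw [this, hr]; push_cast
    have h2 : (r : ZMod 2) + r = 0 := by rw [← two_mul]; exact mul_eq_zero_of_left (by decide) _
    linear_combination (m₄ : ZMod 2) * h2
  -- `ε = M_g(1/2) mod 2`
  obtain ⟨e, he⟩ : ∃ e : ℤ, Mg (1 / 2) = e := by
    have h := hMg_int 1 1
    rwa [show ((1 : ℤ) : ℚ) / 2 ^ 1 = 1 / 2 by norm_num] at h
  -- (1) periodicity
  have hper : ∀ k, Function.Periodic (F k) ((4 : ℤ) ^ k) := by
    intro k b
    show (((2 * (ratPlusSymbol g (((b + 4 ^ k : ℤ) : ℚ) / 4 ^ k) - ratPlusSymbol g 0)).num : ℤ) : ZMod 2) =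
      (((2 * (ratPlusSymbol g ((b : ℚ) / 4 ^ k) - ratPlusSymbol g 0)).num : ℤ) : ZMod 2)
    have : (((b + 4 ^ k : ℤ) : ℚ) / 4 ^ k) = (b : ℚ) / 4 ^ k + ((1 : ℤ) : ℚ) := by
      push_cast; field_simp
    rw [this, ratPlusSymbol_add_intCast_holds]
  -- (2) evenness
  have heven : ∀ k (b : ℤ), F k (-b) = F k b := by
    intro k b
    show (((Mg (((-b : ℤ) : ℚ) / 4 ^ k)).num : ℤ) : ZMod 2) = (((Mg ((b : ℚ) / 4 ^ k)).num : ℤ) : ZMod 2)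
    have : (((-b : ℤ) : ℚ) / 4 ^ k) = -((b : ℚ) / 4 ^ k) := by push_cast; ring
    rw [this, hMg]
    simp only [ratPlusSymbol_neg]
  -- (3) the distribution relation at `x = b/2^{2k+1}`
  have hdist : ∀ k, 1 ≤ k → ∀ b : ℤ, Odd b → F k b + F (k + 1) b + F (k + 1) (b + 2 ^ (2 * k + 1)) =
      (e : ZMod 2) := by
    intro k _ b _
    set x : ℚ := (b : ℚ) / 2 ^ (2 * k + 1) with hx
    obtain ⟨m₁, hm₁⟩ := hMg_int4 (k + 1) b
    obtain ⟨m₂, hm₂⟩ := hMg_int4 (k + 1) (b + 2 ^ (2 * k + 1))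
    obtain ⟨m₃, hm₃⟩ := hMg_int4 k b
    obtain ⟨m₄, hm₄⟩ := hMg_int b (2 * k + 1)
    have hd := distribution_two_mul_ratPlusSymbol_sub g hg hQg h2N₀ ha x
    have e1 : x / 2 = (b : ℚ) / 4 ^ (k + 1) := by
      rw [hx, h4pow]; field_simp; ring
    have e2 : (x + 1) / 2 = ((b + 2 ^ (2 * k + 1) : ℤ) : ℚ) / 4 ^ (k + 1) := by
      rw [hx, h4pow]; push_cast; field_simp; ring
    have e3 : 2 * x = (b : ℚ) / 4 ^ k := by
      rw [hx, h4pow]; field_simp; ring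
    rw [e1, e2, e3] at hd
    rw [hFval _ _ _ hm₃, hFval _ _ _ hm₁, hFval _ _ _ hm₂]
    have := hcast _ _ _ m₁ m₂ m₃ m₄ e hm₁ hm₂ hm₃ (by rw [← hm₄, ← he]; exact hd)
    linear_combination this
  -- (4) the distribution relation at `x = b/2`
  have hdist0 : ∀ b : ℤ, Odd b → F 1 b + F 1 (b + 2) = (e : ZMod 2) := by
    intro b _
    set x : ℚ := (b : ℚ) / 2 with hx
    obtain ⟨m₁, hm₁⟩ := hMg_int4 1 b
    obtain ⟨m₂, hm₂⟩ := hMg_int4 1 (b + 2)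
    obtain ⟨m₄, hm₄⟩ := hMg_int b 1
    have hd := distribution_two_mul_ratPlusSymbol_sub g hg hQg h2N₀ ha x
    have e1 : x / 2 = (b : ℚ) / 4 ^ 1 := by rw [hx]; ring
    have e2 : (x + 1) / 2 = ((b + 2 : ℤ) : ℚ) / 4 ^ 1 := by rw [hx]; push_cast; ring
    have e3 : Mg (2 * x) = ((0 : ℤ) : ℚ) := by
      rw [hx, hMg]
      simp only
      rw [show (2 : ℚ) * ((b : ℚ) / 2) = 0 + ((b : ℤ) : ℚ) by ring, ratPlusSymbol_add_intCast_holds]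
      push_cast; ring
    rw [e1, e2] at hd
    rw [hFval _ _ _ hm₁, hFval _ _ _ hm₂]
    have := hcast _ _ _ m₁ m₂ 0 m₄ e hm₁ hm₂ e3 (by rw [pow_one] at hm₄; rw [← hm₄, ← he]; exact hd)
    simpa using this
  -- suppose, for contradiction, that every `M_f(b/4^k)` is even
  by_contra H
  push Not at H
  have hkill : ∀ k, 1 ≤ k → ∀ b : ℤ, Odd b → ∑ t ∈ S, F k (t * b) = 0 := by
    intro k hk b hb
    obtain ⟨z, hz⟩ := hcong k hk b hb
    -- `M_f(b/4^k)` is an even integer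
    obtain ⟨mf, hmf⟩ := exists_two_mul_ratPlusSymbol_sub_eq_intCast f hrealf
      (x := (b : ℚ) / 4 ^ k) (by rw [h4pow]; exact coprime_den_div_two_pow h2N b (2 * k))
    have hmf_even : Even mf := by
      by_contra hmo
      rw [Int.not_even_iff_odd] at hmo
      exact H k hk b hb mf hmo (by linear_combination hmf / 2)
    -- each `M_g(tb/4^k)` is an integer
    choose m hm using fun t : ℕ ↦ hMg_int4 k ((t : ℤ) * b)
    have hsum : ∑ t ∈ S, F k (t * b) = ((∑ t ∈ S, m t : ℤ) : ZMod 2) := by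
      push_cast
      exact Finset.sum_congr rfl fun t _ ↦ hFval k _ _ (hm t)
    have hm' : ∀ t : ℕ, 2 * (ratPlusSymbol g ((((t : ℤ) * b : ℤ) : ℚ) / 4 ^ k) - ratPlusSymbol g 0) = m t := by
      intro t; have h := hm t; rw [hMg] at h; exact h
    have hZ : (mf : ℚ) - ∑ t ∈ S, (m t : ℚ) = 2 * z := by
      rw [← hmf, ← hz]
      congr 1
      exact Finset.sum_congr rfl fun t _ ↦ (hm' t).symm
    have hZ' : mf - ∑ t ∈ S, m t = 2 * z := by exact_mod_cast hZ
    obtain ⟨r, hr⟩ := hmf_even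
    have : ∑ t ∈ S, m t = r + r - 2 * z := by linarith
    rw [hsum, this]; push_cast
    have h2 : (2 : ZMod 2) = 0 := by decide
    linear_combination ((r : ZMod 2) - z) * h2
  have hzero := OldClassTransport.eq_zero_of_sum_dilations_eq_zero F (e : ZMod 2) hper heven hdist hdist0 S hS hodd hkill
  -- contradiction with the residual hypothesis on `g`
  obtain ⟨k, hk, b, hb, m, hmo, hmeq⟩ := hres
  have hMgm : Mg ((b : ℚ) / 4 ^ k) = m := by rw [hMg]; simp only; rw [hmeq]; ring
  have h1 := hzero k hk b hb
  rw [hFval k b m hMgm] at h1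
  obtain ⟨r, hr⟩ := hmo
  rw [hr] at h1; push_cast at h1
  have h2 : (2 : ZMod 2) = 0 := by decide
  rw [h2, zero_mul, zero_add] at h1
  exact one_ne_zero h1

/-- **The layer-`0` residual certificate.** For a normalised newform `g` of odd level with rational coefficients and
`a₂(g) = a`: if `(a − 3)(a + 1)·[0]⁺_g` is an ODD integer `m` (for the newform of an elliptic curve `A`:
`(a₂(A) − 3)(a₂(A) + 1)·L(A,1)/Ω⁺` odd — a RANK-ZERO unit-L-value anchor), then `[1/4]⁺_g = [0]⁺_g + m/2` with `m` odd,
i.e. the residual hypothesis of `exists_odd_of_plusSymbol_congruence` holds with `k = 1`, `b = 1` (w2 g2's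
`two_mul_ratPlusSymbol_quarter_eq`: `2[1/4]⁺ = (a² − 2a − 1)[0]⁺`). [cite: MazurTateTeitelbaum1986Invent, §I.4 (4.2), §I.8] -/
theorem exists_odd_of_layerZero (hg : IsNewform0 g) (h2N₀ : ¬ 2 ∣ N₀) {a : ℤ} (ha : cuspCoeff g 2 = a) {m : ℤ}
    (hmo : Odd m) (hm : ((a : ℚ) - 3) * (a + 1) * ratPlusSymbol g 0 = m) :
    ∃ k : ℕ, 1 ≤ k ∧ ∃ b : ℤ, Odd b ∧ ∃ m : ℤ, Odd m ∧
      ratPlusSymbol g ((b : ℚ) / 4 ^ k) = ratPlusSymbol g 0 + (m : ℚ) / 2 := by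
  refine ⟨1, le_rfl, 1, odd_one, m, hmo, ?_⟩
  have h := two_mul_ratPlusSymbol_quarter_eq hg h2N₀ ha
  rw [show ((1 : ℤ) : ℚ) / 4 ^ 1 = 1 / 4 by norm_num, ← hm]
  linear_combination h / 2

end Transport

/-! ## §3. The habitat⁺: FLAT at `(W, f)` from the congruence and a residual certificate at a divisor level -/

section Habitat

variable {N : ℕ} [NeZero N] (f : CuspForm (Gamma0 N) 2)

/-- `[x]⁺_f = [0]⁺_f + m/2` with `m` odd ⟹ `|[x]⁺_f|₂ = 2`, for a normalised newform of ODD level with rational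
coefficients and `a₂(f) = 0` (`3[0]⁺ ∈ ℤ`, so `6[x]⁺ = 2k + 3m` is odd; cf. `norm_ratPlusSymbol_eq_two_of_odd`).
[cite: MazurTateTeitelbaum1986Invent, §I.4 (4.2) and §I.8] -/
theorem norm_ratPlusSymbol_eq_two_of_eq_add_half (hf : IsNewform0 f) (hQ : coeffField f = ⊥) (h2N : ¬ 2 ∣ N)
    (ha₂ : cuspCoeff f 2 = 0) {x : ℚ} {m : ℤ} (hmo : Odd m)
    (hx : ratPlusSymbol f x = ratPlusSymbol f 0 + (m : ℚ) / 2) :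
    ‖((ratPlusSymbol f x : ℚ) : ℚ_[2])‖ = 2 := by
  have hreal : ∀ n, (cuspCoeff f n).im = 0 := cuspCoeff_im_eq_zero_of_coeffField_eq_bot hQ
  obtain ⟨k, hk⟩ := exists_three_mul_ratPlusSymbol_zero_eq_intCast hf hreal h2N ha₂
  have h6 : ratPlusSymbol f x = ((2 * k + 3 * m : ℤ) : ℚ) / 6 := by
    rw [hx]; push_cast; linarith
  have hodd : Odd (2 * k + 3 * m) := by
    obtain ⟨t, rfl⟩ := hmo
    exact ⟨k + 3 * t + 1, by ring⟩
  rw [h6]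
  push_cast
  rw [norm_div, show ((2 : ℚ_[2]) * k + 3 * m) = ((2 * k + 3 * m : ℤ) : ℚ_[2]) by push_cast; ring,
    DepletionAtTwo.norm_intCast_eq_one_of_odd hodd,
    show (6 : ℚ_[2]) = ((2 : ℤ) : ℚ_[2]) * ((3 : ℤ) : ℚ_[2]) by norm_num, norm_mul,
    DepletionAtTwo.norm_intCast_eq_one_of_odd (by decide : Odd (3 : ℤ)), mul_one]
  have h2 : ‖((2 : ℤ) : ℚ_[2])‖ = (2 : ℝ)⁻¹ := by
    have := Padic.norm_p (p := 2)
    exact_mod_cast this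
  rw [h2, one_div, inv_inv]

variable {W : WeierstrassCurve ℚ} [W.IsElliptic] [W.IsGloballyMinimal]

/-- **FLAT at `(W, f)` by OLD-CLASS DESCENT.** Let `W/ℚ` be good supersingular at `2` with `a₂(W) = 0`, `f` its newform
(level `N_W`, odd), and `g` a normalised newform of odd level `N₀` with rational coefficients and `a₂(g) = a` even
(e.g. the newform of a congruent anchor curve `A` with `N_A ∣ N_W`). ASSUME (C): for `k ≥ 1`, `b` odd,
`2([b/4^k]⁺_f − [0]⁺_f) − ∑_{t∈S} 2([tb/4^k]⁺_g − [0]⁺_g) ∈ 2ℤ` (`S ≠ ∅` finite, odd) — the restriction to the even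
`2`-power cusp loops of «the mod-2 plus character of `f` is the old class `∑_{t∈S} α_t^*χ_g`», which mod-2 multiplicity
one at level `N_W` (Buzzard 2000, Prop. 2.4; `W[2]` is ramified at `2`) and Ihara's lemma mod 2 produce when
`W[2] ≃ ρ̄_g` — and ASSUME the residual certificate «some `[b/4^k]⁺_g − [0]⁺_g` is half an ODD integer». THEN
`2 ∤ L♭` for every Pollack pair `(L♯, L♭)` of `f` at `2` (μ(L♭_f) = 0), through §2, the relocation
`exists_ratPlusSymbol_pow_cyclotomicGenerator_eq` and the FlatSymbols door `flatAtTwo_of_two_le_norm_ratPlusSymbol`.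
BSD is not proved by this; (C) and the residual certificate are hypotheses. [cite: Buzzard2000, Prop. 2.4] [cite: Pollack2003, Conj. 6.3 and Prop. 6.18] [cite: EmertonPollackWeston2006, §4.4] -/
theorem flatAtTwo_of_plusSymbol_congruence [NeZero (W.conductorNorm ℤ)]
    {f : CuspForm (Gamma0 (W.conductorNorm ℤ)) 2} (hf : IsNewformOf W f) (hss : GoodSS W 2)
    (ha : W.frobeniusTrace 2 = 0)
    {N₀ : ℕ} [NeZero N₀] (g : CuspForm (Gamma0 N₀) 2) (hg : IsNewform0 g) (hQg : coeffField g = ⊥)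
    (h2N₀ : ¬ 2 ∣ N₀) {a : ℤ} (hag : cuspCoeff g 2 = a) (haev : Even a)
    (S : Finset ℕ) (hS : S.Nonempty) (hodd : ∀ t ∈ S, Odd t)
    (hcong : ∀ k : ℕ, 1 ≤ k → ∀ b : ℤ, Odd b → ∃ z : ℤ,
      2 * (ratPlusSymbol f ((b : ℚ) / 4 ^ k) - ratPlusSymbol f 0) -
        ∑ t ∈ S, 2 * (ratPlusSymbol g ((((t : ℤ) * b : ℤ) : ℚ) / 4 ^ k) - ratPlusSymbol g 0) = 2 * z)
    (hres : ∃ k : ℕ, 1 ≤ k ∧ ∃ b : ℤ, Odd b ∧ ∃ m : ℤ, Odd m ∧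
      ratPlusSymbol g ((b : ℚ) / 4 ^ k) = ratPlusSymbol g 0 + (m : ℚ) / 2) :
    ∀ Lplus Lminus : IwasawaAlgebra 2, IsPollackPair f 2 Lplus Lminus → ¬ PowerSeries.C (2 : ℤ_[2]) ∣ Lminus := by
  have h2N : ¬ 2 ∣ W.conductorNorm ℤ := not_two_dvd_conductorNorm_of_goodSS hss
  have ha₂ : cuspCoeff f 2 = 0 := by
    rw [hf.2 2, W.LFunction_apply_prime_eq_frobeniusTrace 2 hss.1, ha]; simp
  obtain ⟨k, hk, b, hb, m, hmo, hmeq⟩ := exists_odd_of_plusSymbol_congruence f g hf.coeffField_eq_bot h2N hg hQg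
    h2N₀ hag haev S hS hodd hcong hres
  have hnorm := norm_ratPlusSymbol_eq_two_of_eq_add_half f hf.1 hf.coeffField_eq_bot h2N ha₂ hmo hmeq
  -- relocate `b/4^k` to the Mazur–Tate indexing `5^s/2^{(2k-2)+2}`
  have hd : ((4 : ℤ) ^ k).natAbs = 2 ^ ((2 * k - 2) + 2) := by
    rw [Int.natAbs_pow, show (4 : ℤ).natAbs = 2 ^ 2 by decide, ← pow_mul]
    congr 1; omega
  obtain ⟨s, hs⟩ := exists_ratPlusSymbol_pow_cyclotomicGenerator_eq f hb (2 * k - 2) hd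
  have hcast : ((b : ℚ) / (((4 : ℤ) ^ k : ℤ) : ℚ)) = (b : ℚ) / 4 ^ k := by push_cast; rfl
  rw [hcast] at hs
  refine flatAtTwo_of_two_le_norm_ratPlusSymbol (n := 2 * k - 2) ⟨k - 1, by omega⟩ (s := s) ?_
  rw [hs, hnorm]

/-- **FLAT from a RANK-ZERO ANCHOR at a divisor level** (the layer-`0` case of the residual certificate): as in
`flatAtTwo_of_plusSymbol_congruence`, with the residual input replaced by «`(a − 3)(a + 1)·[0]⁺_g` is an odd integer»
(`exists_odd_of_layerZero`; for `g = f_A`: `(a₂(A) − 3)(a₂(A) + 1)·L(A,1)/Ω⁺_A` odd). So a habitat⁺ class `W` of analytic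
rank ONE inherits FLAT from a congruent rank-ZERO curve `A` with `N_A ∣ N_W` and unit `L`-value, granted the plus-symbol
congruence (C). BSD is not proved by this. [cite: Buzzard2000, Prop. 2.4] [cite: Pollack2003, Conj. 6.3 and Prop. 6.18] -/
theorem flatAtTwo_of_plusSymbol_congruence_of_layerZero [NeZero (W.conductorNorm ℤ)]
    {f : CuspForm (Gamma0 (W.conductorNorm ℤ)) 2} (hf : IsNewformOf W f) (hss : GoodSS W 2)
    (ha : W.frobeniusTrace 2 = 0)
    {N₀ : ℕ} [NeZero N₀] (g : CuspForm (Gamma0 N₀) 2) (hg : IsNewform0 g) (hQg : coeffField g = ⊥)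
    (h2N₀ : ¬ 2 ∣ N₀) {a : ℤ} (hag : cuspCoeff g 2 = a) (haev : Even a)
    {m : ℤ} (hmo : Odd m) (hm : ((a : ℚ) - 3) * (a + 1) * ratPlusSymbol g 0 = m)
    (S : Finset ℕ) (hS : S.Nonempty) (hodd : ∀ t ∈ S, Odd t)
    (hcong : ∀ k : ℕ, 1 ≤ k → ∀ b : ℤ, Odd b → ∃ z : ℤ,
      2 * (ratPlusSymbol f ((b : ℚ) / 4 ^ k) - ratPlusSymbol f 0) -
        ∑ t ∈ S, 2 * (ratPlusSymbol g ((((t : ℤ) * b : ℤ) : ℚ) / 4 ^ k) - ratPlusSymbol g 0) = 2 * z) :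
    ∀ Lplus Lminus : IwasawaAlgebra 2, IsPollackPair f 2 Lplus Lminus → ¬ PowerSeries.C (2 : ℤ_[2]) ∣ Lminus :=
  flatAtTwo_of_plusSymbol_congruence hf hss ha g hg hQg h2N₀ hag haev S hS hodd hcong
    (exists_odd_of_layerZero g hg h2N₀ hag hmo hm)

end Habitat

end Summit.BirchSwinnertonDyer.BirchSwinnertonDyer.Theorems.SignedMuAtTwo

end
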